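import Literature.NumberTheory.Weil1964.ArchVacuumSectionPlaces
import Literature.RepresentationTheory.KonnoKonno2007.JunctionVacuumSectionSwap
import HarnessLib

/-!
# Reindexed and slice-by-slice phase maps as homomorphisms into the symplectic group (Weil 1964, n° 12)

Topic `NumberTheory/Weil1964`; namespace `Literature.NumberTheory.Weil1964`.  KERNEL MATHEMATICS ONLY: five explicit
definitions (linear isomorphisms / group homomorphisms) and proved theorems; no `def … : Prop` record, no axiom, no proof hole.

The archimedean phase-space action of the pair group of a hermitian dual pair over a CM field is written, in weil-2's scaled
Folland frame, as the slice-by-slice phase map `placePhase (v ↦ reindexPhase (ε v) ⇑(ι𝕎ᵥ gᵥ))` of Konno–Konno's real pairs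
(`ArchDualPairThetaMajorants.archPhaseMap_toSp_pair`; `placePhase` of `ArchVacuumSectionPlaces`, `reindexPhase` of
`KonnoKonno2007/JunctionVacuumSectionSwap`).  The tree's `IsArchWeilDatum ι𝕎 ω` is indexed by a HOMOMORPHISM
`ι𝕎 : G →* Sp(ℝ^σ × ℝ^σ)` (dot pairing), so a consumer needs these phase maps AS symplectic-group-valued homomorphisms:

* §1 `reindexPV ε` — `(p, q) ↦ (p ∘ ε, q ∘ ε)`, a linear isomorphism `ℝ^{σ′} × ℝ^{σ′} ≃ ℝ^σ × ℝ^σ`;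
  **`reindexSp ε : Sp(σ′) →* Sp(σ)`** (conjugation by `reindexPV ε`) with `⇑(reindexSp ε g) = reindexPhase ε ⇑g`
  (`coe_reindexSp`);
* §2 `placePV g` — the linear automorphism of `ℝ^{ι×o} × ℝ^{ι×o}` acting on the slice `{(·, v)}` by `g v`;
  **`placeSp : (Π v, Sp(ι)) →* Sp(ι × o)`** with `⇑(placeSp g) = placePhase (v ↦ ⇑(g v))` (`coe_placeSp`) — the dot
  pairing of `ι × o` is the sum of the dot pairings of the slices (`dotProduct_eq_sum_slices`);
* §3 **`piPhaseHom ε ι𝕎ᵥ : (Π v, G v) →* Sp(ι × o)`** for a family of homomorphisms `ι𝕎ᵥ : G v →* Sp(σ v)` and frames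
  `ε v : ι ≃ σ v`, with `⇑(piPhaseHom ε ι𝕎ᵥ g) = placePhase (v ↦ reindexPhase (ε v) ⇑(ι𝕎ᵥ (g v)))` (`coe_piPhaseHom`) —
  LITERALLY the phase action of `ArchLeviKAKInput.kakImplementerData_leviFamily_places_reindex`, so the dictionary
  hypothesis `γ (ϖ u) = ⇑(ι𝕎 u)` of `ArchWeilDatumOfCoefficients.isArchWeilDatum_of_coeff` holds by `rfl` for
  `ι𝕎 := (piPhaseHom ε ι𝕎ᵥ).comp ϖ`.

Everything is PROVED; no cited statement is a hypothesis.

## References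

* [Weil1964] A. Weil, *Sur certains groupes d'opérateurs unitaires*, Acta Math. 111 (1964), Chap. I n° 12 p. 160
  (direct sums of symplectic spaces), Chap. III n° 37 (products over places).
* [MoeglinVignerasWaldspurger1987] C. Mœglin, M.-F. Vignéras, J.-L. Waldspurger, *Correspondances de Howe sur un corps
  p-adique*, LNM 1291 (1987), Ch. 1 I.17 (the pair group inside `Sp(𝕎)`).

## Provenance

LEAN-IN-TREE rule (2026-08-18), pub-hodgecm model-construction sub-cell, discharge seat mc-discharge-3 (ticket D-3 follow-on:
the phase HOMOMORPHISM over which the (J-arch) datum `IsArchWeilDatum ι𝕎 (repTransport e′ archWeilRep)` is indexed — binder-2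
HANDOFF-g6 §7 «missing link»).  Nothing here is a claim of the manuscripts adjudicated by that cell.
-/

noncomputable section

open Matrix

namespace Literature.NumberTheory.Weil1964

open Literature.Analysis.SegalBargmann Literature.RepresentationTheory.HeisenbergGroup
open Literature.RepresentationTheory.KonnoKonno2007

/-! ## §1 Reindexing -/

section Reindex

variable {σ σ' : Type*} [Fintype σ] [Fintype σ']

/-- **Phase-space reindexing** `(p, q) ↦ (p ∘ ε, q ∘ ε) : ℝ^{σ′} × ℝ^{σ′} ≃ₗ ℝ^σ × ℝ^σ`. [folklore] -/
def reindexPV (ε : σ ≃ σ') : ((σ' → ℝ) × (σ' → ℝ)) ≃ₗ[ℝ] ((σ → ℝ) × (σ → ℝ)) where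
  toFun pq := (pq.1 ∘ ε, pq.2 ∘ ε)
  invFun pq := (pq.1 ∘ ε.symm, pq.2 ∘ ε.symm)
  map_add' _ _ := rfl
  map_smul' _ _ := rfl
  left_inv pq := by
    refine Prod.ext (funext fun i => ?_) (funext fun i => ?_) <;>
      simp only [Function.comp_apply, Equiv.apply_symm_apply]
  right_inv pq := by
    refine Prod.ext (funext fun i => ?_) (funext fun i => ?_) <;>
      simp only [Function.comp_apply, Equiv.symm_apply_apply]

omit [Fintype σ] [Fintype σ'] in
/-- unfolding. [folklore] -/
@[simp] theorem reindexPV_apply (ε : σ ≃ σ') (pq : (σ' → ℝ) × (σ' → ℝ)) :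
    reindexPV ε pq = (pq.1 ∘ ε, pq.2 ∘ ε) := rfl

omit [Fintype σ] [Fintype σ'] in
/-- unfolding of the inverse. [folklore] -/
@[simp] theorem reindexPV_symm_apply (ε : σ ≃ σ') (pq : (σ → ℝ) × (σ → ℝ)) :
    (reindexPV ε).symm pq = (pq.1 ∘ ε.symm, pq.2 ∘ ε.symm) := rfl

/-- **Conjugation by the reindexing preserves symplecticity** (the dot pairing is reindexing-invariant).
[cite: Weil1964, Chap. I n° 12, p. 160] -/
theorem reindexPV_conj_mem_symplecticGroup (ε : σ ≃ σ') {g : ((σ' → ℝ) × (σ' → ℝ)) ≃ₗ[ℝ] ((σ' → ℝ) × (σ' → ℝ))}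
    (hg : g ∈ symplecticGroup (polar (dotPairing σ'))) :
    (reindexPV ε).symm.trans (g.trans (reindexPV ε)) ∈ symplecticGroup (polar (dotPairing σ)) := by
  rw [mem_symplecticGroup] at hg ⊢
  intro w w'
  have h := hg ((reindexPV ε).symm w) ((reindexPV ε).symm w')
  simp only [LinearEquiv.trans_apply, polar_apply, dotPairing_apply, reindexPV_apply, reindexPV_symm_apply,
    comp_equiv_dotProduct_comp_equiv] at h ⊢
  exact h

/-- **`reindexSp ε : Sp(ℝ^{σ′} × ℝ^{σ′}) →* Sp(ℝ^σ × ℝ^σ)`**, `g ↦ reindexPV ε ∘ g ∘ (reindexPV ε)⁻¹`.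
[cite: Weil1964, Chap. I n° 12, p. 160] -/
def reindexSp (ε : σ ≃ σ') : symplecticGroup (polar (dotPairing σ')) →* symplecticGroup (polar (dotPairing σ)) where
  toFun g := ⟨(reindexPV ε).symm.trans ((g.1 : ((σ' → ℝ) × (σ' → ℝ)) ≃ₗ[ℝ] ((σ' → ℝ) × (σ' → ℝ))).trans
    (reindexPV ε)), reindexPV_conj_mem_symplecticGroup ε g.2⟩
  map_one' := Subtype.ext (LinearEquiv.ext fun pq => by
    simp only [OneMemClass.coe_one, LinearEquiv.trans_apply, LinearEquiv.coe_one, id_eq,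
      LinearEquiv.apply_symm_apply])
  map_mul' g h := Subtype.ext (LinearEquiv.ext fun pq => by
    simp only [Subgroup.coe_mul, LinearEquiv.trans_apply, LinearEquiv.mul_apply, LinearEquiv.symm_apply_apply])

/-- pointwise: `reindexSp ε g (p,q) = reindexPV ε (g ((reindexPV ε)⁻¹ (p,q)))`. [folklore] -/
theorem coe_reindexSp_apply (ε : σ ≃ σ') (g : symplecticGroup (polar (dotPairing σ'))) (pq : (σ → ℝ) × (σ → ℝ)) :
    ((reindexSp ε g).1 : ((σ → ℝ) × (σ → ℝ)) ≃ₗ[ℝ] ((σ → ℝ) × (σ → ℝ))) pq =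
      reindexPV ε ((g.1 : ((σ' → ℝ) × (σ' → ℝ)) ≃ₗ[ℝ] ((σ' → ℝ) × (σ' → ℝ))) ((reindexPV ε).symm pq)) := rfl

/-- **`reindexSp ε g` acts on phase space by `reindexPhase ε ⇑g`** (the phase map of
`KonnoKonno2007/JunctionVacuumSectionSwap`). [folklore] -/
theorem coe_reindexSp (ε : σ ≃ σ') (g : symplecticGroup (polar (dotPairing σ'))) :
    (⇑((reindexSp ε g).1 : ((σ → ℝ) × (σ → ℝ)) ≃ₗ[ℝ] ((σ → ℝ) × (σ → ℝ))) : PhaseMap σ) =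
      reindexPhase ε (⇑(g.1 : ((σ' → ℝ) × (σ' → ℝ)) ≃ₗ[ℝ] ((σ' → ℝ) × (σ' → ℝ)))) :=
  funext fun _ => rfl

end Reindex

/-! ## §2 Slice by slice over a finite set of places -/

section Places

variable {ι : Type} [Fintype ι] {o : Type} [Fintype o]

/-- the slice `{(·, v)}` of a phase-space vector, a linear map `ℝ^{ι×o} × ℝ^{ι×o} → ℝ^ι × ℝ^ι`. [folklore] -/
def slicePV (v : o) : ((ι × o → ℝ) × (ι × o → ℝ)) →ₗ[ℝ] ((ι → ℝ) × (ι → ℝ)) where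
  toFun pq := (fun j => pq.1 (j, v), fun j => pq.2 (j, v))
  map_add' _ _ := rfl
  map_smul' _ _ := rfl

omit [Fintype ι] [Fintype o] in
/-- unfolding. [folklore] -/
@[simp] theorem slicePV_apply (v : o) (pq : (ι × o → ℝ) × (ι × o → ℝ)) :
    slicePV v pq = (fun j => pq.1 (j, v), fun j => pq.2 (j, v)) := rfl

omit [Fintype ι] [Fintype o] in
/-- `placePhase γ` read through the slices. [folklore] -/
theorem placePhase_apply_eq (γ : o → PhaseMap ι) (pq : (ι × o → ℝ) × (ι × o → ℝ)) :
    placePhase γ pq = (fun k => (γ k.2 (slicePV k.2 pq)).1 k.1, fun k => (γ k.2 (slicePV k.2 pq)).2 k.1) := rfl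

/-- **The dot product on `ι × o` is the sum over `o` of the dot products of the slices.** [folklore] -/
theorem dotProduct_eq_sum_slices (x y : ι × o → ℝ) :
    x ⬝ᵥ y = ∑ v, (fun j => x (j, v)) ⬝ᵥ (fun j => y (j, v)) := by
  simp only [dotProduct]
  rw [Fintype.sum_prod_type_right]

/-- **`placePV g`**: the linear automorphism of `ℝ^{ι×o} × ℝ^{ι×o}` acting on the slice `{(·, v)}` by `g v`
(`= placePhase (v ↦ ⇑(g v))`). [folklore] -/
def placePV (g : o → (((ι → ℝ) × (ι → ℝ)) ≃ₗ[ℝ] ((ι → ℝ) × (ι → ℝ)))) :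
    ((ι × o → ℝ) × (ι × o → ℝ)) ≃ₗ[ℝ] ((ι × o → ℝ) × (ι × o → ℝ)) where
  toFun := placePhase fun v => ⇑(g v)
  invFun := placePhase fun v => ⇑(g v).symm
  map_add' a b := by
    refine Prod.ext (funext fun k => ?_) (funext fun k => ?_)
    · obtain ⟨i, v⟩ := k
      show (g v (slicePV v (a + b))).1 i = (g v (slicePV v a)).1 i + (g v (slicePV v b)).1 i
      rw [map_add, map_add, Prod.fst_add, Pi.add_apply]
    · obtain ⟨i, v⟩ := k
      show (g v (slicePV v (a + b))).2 i = (g v (slicePV v a)).2 i + (g v (slicePV v b)).2 i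
      rw [map_add, map_add, Prod.snd_add, Pi.add_apply]
  map_smul' r a := by
    refine Prod.ext (funext fun k => ?_) (funext fun k => ?_)
    · obtain ⟨i, v⟩ := k
      show (g v (slicePV v (r • a))).1 i = r • (g v (slicePV v a)).1 i
      rw [map_smul, map_smul, Prod.smul_fst, Pi.smul_apply]
    · obtain ⟨i, v⟩ := k
      show (g v (slicePV v (r • a))).2 i = r • (g v (slicePV v a)).2 i
      rw [map_smul, map_smul, Prod.smul_snd, Pi.smul_apply]
  left_inv pq := by
    have h : (fun v => ((⇑(g v).symm : PhaseMap ι) ∘ (⇑(g v) : PhaseMap ι))) = fun _ : o => (id : PhaseMap ι) :=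
      funext fun v => funext fun x => (g v).symm_apply_apply x
    have h2 := congrFun (placePhase_comp (fun v => (⇑(g v).symm : PhaseMap ι)) (fun v => ⇑(g v))) pq
    rw [h, placePhase_id] at h2
    exact h2.symm
  right_inv pq := by
    have h : (fun v => ((⇑(g v) : PhaseMap ι) ∘ (⇑(g v).symm : PhaseMap ι))) = fun _ : o => (id : PhaseMap ι) :=
      funext fun v => funext fun x => (g v).apply_symm_apply x
    have h2 := congrFun (placePhase_comp (fun v => (⇑(g v) : PhaseMap ι)) (fun v => ⇑(g v).symm)) pq
    rw [h, placePhase_id] at h2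
    exact h2.symm

omit [Fintype ι] [Fintype o] in
/-- `⇑(placePV g) = placePhase (v ↦ ⇑(g v))`. [folklore] -/
@[simp] theorem coe_placePV (g : o → (((ι → ℝ) × (ι → ℝ)) ≃ₗ[ℝ] ((ι → ℝ) × (ι → ℝ)))) :
    (⇑(placePV g) : PhaseMap (ι × o)) = placePhase fun v => ⇑(g v) := rfl

omit [Fintype ι] [Fintype o] in
/-- the slices of `placePV g pq` are `g v (slice pq)`. [folklore] -/
theorem slicePV_placePV (g : o → (((ι → ℝ) × (ι → ℝ)) ≃ₗ[ℝ] ((ι → ℝ) × (ι → ℝ)))) (v : o)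
    (pq : (ι × o → ℝ) × (ι × o → ℝ)) : slicePV v (placePV g pq) = g v (slicePV v pq) := rfl

/-- **Slice-by-slice symplectic maps are symplectic** for the dot pairing of `ι × o`.
[cite: Weil1964, Chap. I n° 12, p. 160] -/
theorem placePV_mem_symplecticGroup {g : o → (((ι → ℝ) × (ι → ℝ)) ≃ₗ[ℝ] ((ι → ℝ) × (ι → ℝ)))}
    (hg : ∀ v, g v ∈ symplecticGroup (polar (dotPairing ι))) :
    placePV g ∈ symplecticGroup (polar (dotPairing (ι × o))) := by
  rw [mem_symplecticGroup]
  intro w w'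
  simp only [polar_apply, dotPairing_apply]
  rw [dotProduct_eq_sum_slices (placePV g w).1, dotProduct_eq_sum_slices (placePV g w').1,
    dotProduct_eq_sum_slices w.1, dotProduct_eq_sum_slices w'.1, ← Finset.sum_sub_distrib,
    ← Finset.sum_sub_distrib]
  refine Finset.sum_congr rfl fun v _ => ?_
  have h := (mem_symplecticGroup _ _).1 (hg v) (slicePV v w) (slicePV v w')
  simp only [polar_apply, dotPairing_apply, slicePV_apply] at h
  have h1 : (fun j => (placePV g w).1 (j, v)) = (g v (slicePV v w)).1 := congrArg Prod.fst (slicePV_placePV g v w)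
  have h2 : (fun j => (placePV g w).2 (j, v)) = (g v (slicePV v w)).2 := congrArg Prod.snd (slicePV_placePV g v w)
  have h1' : (fun j => (placePV g w').1 (j, v)) = (g v (slicePV v w')).1 := congrArg Prod.fst (slicePV_placePV g v w')
  have h2' : (fun j => (placePV g w').2 (j, v)) = (g v (slicePV v w')).2 := congrArg Prod.snd (slicePV_placePV g v w')
  rw [h1, h2, h1', h2']
  simpa only [slicePV_apply] using h

/-- **`placeSp : (Π v, Sp(ℝ^ι × ℝ^ι)) →* Sp(ℝ^{ι×o} × ℝ^{ι×o})`**, slice by slice.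
[cite: Weil1964, Chap. I n° 12, p. 160] -/
def placeSp : (∀ _ : o, symplecticGroup (polar (dotPairing ι))) →* symplecticGroup (polar (dotPairing (ι × o))) where
  toFun g := ⟨placePV fun v => ((g v).1 : ((ι → ℝ) × (ι → ℝ)) ≃ₗ[ℝ] ((ι → ℝ) × (ι → ℝ))),
    placePV_mem_symplecticGroup fun v => (g v).2⟩
  map_one' := Subtype.ext (LinearEquiv.ext fun pq => by
    change placePhase (fun v => ⇑(((1 : ∀ _ : o, symplecticGroup (polar (dotPairing ι))) v).1 :
      ((ι → ℝ) × (ι → ℝ)) ≃ₗ[ℝ] ((ι → ℝ) × (ι → ℝ)))) pq = pq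
    have h : (fun v => (⇑(((1 : ∀ _ : o, symplecticGroup (polar (dotPairing ι))) v).1 :
        ((ι → ℝ) × (ι → ℝ)) ≃ₗ[ℝ] ((ι → ℝ) × (ι → ℝ))) : PhaseMap ι)) = fun _ : o => (id : PhaseMap ι) :=
      funext fun v => funext fun x => rfl
    rw [h, placePhase_id]; rfl)
  map_mul' g h := Subtype.ext (LinearEquiv.ext fun pq => by
    change placePhase (fun v => ⇑(((g * h) v).1 : ((ι → ℝ) × (ι → ℝ)) ≃ₗ[ℝ] ((ι → ℝ) × (ι → ℝ)))) pq =
      placePhase (fun v => ⇑((g v).1 : ((ι → ℝ) × (ι → ℝ)) ≃ₗ[ℝ] ((ι → ℝ) × (ι → ℝ))))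
        (placePhase (fun v => ⇑((h v).1 : ((ι → ℝ) × (ι → ℝ)) ≃ₗ[ℝ] ((ι → ℝ) × (ι → ℝ)))) pq)
    have hc : (fun v => (⇑(((g * h) v).1 : ((ι → ℝ) × (ι → ℝ)) ≃ₗ[ℝ] ((ι → ℝ) × (ι → ℝ))) : PhaseMap ι)) =
        fun v => (⇑((g v).1 : ((ι → ℝ) × (ι → ℝ)) ≃ₗ[ℝ] ((ι → ℝ) × (ι → ℝ))) : PhaseMap ι) ∘
          ⇑((h v).1 : ((ι → ℝ) × (ι → ℝ)) ≃ₗ[ℝ] ((ι → ℝ) × (ι → ℝ))) :=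
      funext fun v => funext fun x => rfl
    rw [hc, placePhase_comp]; rfl)

/-- **`placeSp g` acts on phase space by `placePhase (v ↦ ⇑(g v))`.** [folklore] -/
theorem coe_placeSp (g : ∀ _ : o, symplecticGroup (polar (dotPairing ι))) :
    (⇑((placeSp g).1 : ((ι × o → ℝ) × (ι × o → ℝ)) ≃ₗ[ℝ] ((ι × o → ℝ) × (ι × o → ℝ))) : PhaseMap (ι × o)) =
      placePhase fun v => ⇑((g v).1 : ((ι → ℝ) × (ι → ℝ)) ≃ₗ[ℝ] ((ι → ℝ) × (ι → ℝ))) := rfl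

/-! ## §3 Families of homomorphisms on their own index types -/

/-- **`piPhaseHom ε ι𝕎ᵥ : (Π v, G v) →* Sp(ℝ^{ι×o} × ℝ^{ι×o})`**: the product over places of the homomorphisms
`ι𝕎ᵥ : G v →* Sp(ℝ^{σ v} × ℝ^{σ v})` relabelled to the common index `ι` by `ε v : ι ≃ σ v`, slice by slice.
[cite: Weil1964, Chap. I n° 12, p. 160; MoeglinVignerasWaldspurger1987, Ch. 1 I.17] -/
def piPhaseHom {σ : o → Type*} [∀ v, Fintype (σ v)] {G : o → Type*} [∀ v, Group (G v)] (ε : ∀ v, ι ≃ σ v)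
    (ι𝕎v : ∀ v, G v →* symplecticGroup (polar (dotPairing (σ v)))) :
    (∀ v, G v) →* symplecticGroup (polar (dotPairing (ι × o))) :=
  placeSp.comp (MonoidHom.pi fun v => (reindexSp (ε v)).comp ((ι𝕎v v).comp (Pi.evalMonoidHom G v)))

/-- **The phase action of `piPhaseHom ε ι𝕎ᵥ g` is `placePhase (v ↦ reindexPhase (ε v) ⇑(ι𝕎ᵥ (g v)))`** — literally the
phase action `γ` of `ArchLeviKAKInput.kakImplementerData_leviFamily_places_reindex` and of the dictionary
`ArchDualPairThetaMajorants.archPhaseMap_toSp_pair`. [folklore] -/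
theorem coe_piPhaseHom {σ : o → Type*} [∀ v, Fintype (σ v)] {G : o → Type*} [∀ v, Group (G v)] (ε : ∀ v, ι ≃ σ v)
    (ι𝕎v : ∀ v, G v →* symplecticGroup (polar (dotPairing (σ v)))) (g : ∀ v, G v) :
    (⇑((piPhaseHom ε ι𝕎v g).1 : ((ι × o → ℝ) × (ι × o → ℝ)) ≃ₗ[ℝ] ((ι × o → ℝ) × (ι × o → ℝ))) :
        PhaseMap (ι × o)) =
      placePhase fun v => reindexPhase (ε v)
        (⇑((ι𝕎v v (g v)).1 : ((σ v → ℝ) × (σ v → ℝ)) ≃ₗ[ℝ] ((σ v → ℝ) × (σ v → ℝ)))) := rfl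

/-- pointwise form of `coe_piPhaseHom` (the `hdict` hypothesis of `isArchWeilDatum_of_coeff`, by `rfl`, for
`ι𝕎 := (piPhaseHom ε ι𝕎ᵥ).comp ϖ`). [folklore] -/
theorem piPhaseHom_apply_apply {σ : o → Type*} [∀ v, Fintype (σ v)] {G : o → Type*} [∀ v, Group (G v)]
    (ε : ∀ v, ι ≃ σ v) (ι𝕎v : ∀ v, G v →* symplecticGroup (polar (dotPairing (σ v))))
    {H : Type*} [Group H] (ϖ : H →* ∀ v, G v) (u : H) (pq : (ι × o → ℝ) × (ι × o → ℝ)) :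
    (placePhase fun v => reindexPhase (ε v)
        (⇑((ι𝕎v v (ϖ u v)).1 : ((σ v → ℝ) × (σ v → ℝ)) ≃ₗ[ℝ] ((σ v → ℝ) × (σ v → ℝ))))) pq =
      ((((piPhaseHom ε ι𝕎v).comp ϖ) u).1 : ((ι × o → ℝ) × (ι × o → ℝ)) ≃ₗ[ℝ] ((ι × o → ℝ) × (ι × o → ℝ))) pq :=
  rfl

end Places

end Literature.NumberTheory.Weil1964
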